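import Summits.QuantumFields.BalabanUV.Beta.GAN24.DerivativeRateTransferAnalyticMixed
import Literature.MathematicalPhysics.QuantumFieldTheory.Balaban1983to89.B8SectDSource

/-!
# `BalabanUV.Beta.GAN24.DerivativeRateTransferAnalyticResolvent` — binder row G-an2-4 ∕ (CONV-C), route R6 «VALUES, NOT DERIVATIVES», PART 10:
# S2ω AT MODEL LEVEL FOR RESOLVENT-TYPE (Γ-BLOCK) ENTRIES — «analyticity passes through the Neumann inversion»: if the OPERATOR family
# `T(s,t)` is holomorphic on the bidisc with `‖T‖ ≤ ϑ < 1`, every ENTRY `φ((1 + T(s,t))⁻¹ f)` of the inverse is JOINTLY holomorphic there with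
# the ONE bound `‖φ‖·‖f‖∕(1 − ϑ)` — exactly the hypotheses `hF`, `hB` of PART 8's `derivMixed_step_rateω`; for the AFFINE two-bond perturbation
# `T(s,t) = s•A + t•B` on the bidisc of radius `ρ` with `ρ·(‖A‖ + ‖B‖) ≤ ½` the bound is `2‖φ‖‖f‖`, and PART 8 then turns a VALUE rate on the
# real square into the MIXED-derivative rate with NO analytic hypothesis left (unit b2b-balaban-gan24-p3, gen 34; v1)

NOT IN PRINT; OUR PROOF (for the ROUTE; [folklore] — the Neumann API of the tree's Literature file `Balaban1983to89.B8SectDSource` §3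
(`isUnit_one_add`, `norm_inverse_one_add_apply_le`, `differentiableAt_inverse_one_add_apply`: [Balaban1985RegularSpaces] (1.96) p. 92, PROVED there as
elementary API) BY NAME, Mathlib's `DifferentiableAt.inverse`, PART 8 BY NAME).  HONEST FRAMING (cell contract, verbatim): «discharging `BetaPertH`
makes Bałaban's UV stability UNCONDITIONAL — a real constructive-QFT result; it is NOT the continuum limit and NOT the Clay problem.»  HONEST DEPENDENCY
(verbatim): «continuum YM on T⁴ ⇐ BetaPertH ∧ nine spine estimates (0/9 proved); BetaPertH ⇐ (D1) ∧ (D4) ∧ CAP+tail; G-an2-4 gates asym, D1 and NE2/3/4.»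

WHY THIS FILE.  PARTs 7–9 reduce the u-rows of (CONV-C) along R6's two-bond background family to S1 (a VALUE rate on the real segment∕square) plus
S2ω: «the entry family extends holomorphically to a complex disc∕bidisc with ONE uniform bound» — the printed KIND of input being
[Balaban1985BackgroundPropagators] §B p. 399–400 «The simplest way to do it is to extend the operators to configurations with values in the
complexified group G^c and to prove the usual complex analyticity» (CONTEXT only; nothing printed is used).  At MODEL level the blocks of
`M_k(B)⁻¹` are inverses (and Schur complements of inverses — an1's `Beta.Envelope`) of OPERATOR families depending holomorphically on the
background parameters; THIS FILE records the one step that carries S2ω from the OPERATOR family to the ENTRIES OF ITS INVERSE: the Neumann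
inversion on a Banach space.  So for Γ-type (resolvent) blocks the analytic hypothesis of PARTs 7–9 is discharged by an operator-level
smallness `‖T(s,t)‖ ≤ ϑ < 1` on the bidisc — automatic for an affine perturbation on a small enough bidisc (§2) — and ONLY S1 remains.

WHAT THIS FILE PROVES (0 sorry, 0 `def`; `F` a complex Banach space, `T : E → (F →L[ℂ] F)` on a complex normed parameter space `E` (§1; `E = ℂ × ℂ` in §2–§3, `E = ℂ` the one-bond case), `φ : F →L[ℂ] ℂ`, `f : F`):
* §1 **`differentiableOn_resolventEntry`** (`T` holomorphic on an open `U` with `‖T z‖ < 1` there ⇒ `z ↦ φ ((1 + T z)⁻¹ʳ f)` holomorphic on `U`),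
  **`norm_resolventEntry_le`** (`‖T z‖ ≤ ϑ < 1` ⇒ `‖φ ((1 + T z)⁻¹ʳ f)‖ ≤ ‖φ‖·‖f‖∕(1 − ϑ)`);
* §2 the AFFINE two-bond perturbation `z ↦ z.1 • A + z.2 • B`: `differentiable_affine₂`, `norm_affine₂_le` (`≤ ρ(‖A‖ + ‖B‖)` on the bidisc of
  radius `ρ`), `norm_affine₂_le_half` (`ρ(‖A‖ + ‖B‖) ≤ ½ ⇒ ≤ ½`), **`resolventEntry_affine₂_hF`** ∕ **`resolventEntry_affine₂_hB`** — PART 8's two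
  analytic hypotheses for `F(s,t) = φ((1 + sA + tB)⁻¹ʳ f)` on `ball 0 ρ ×ˢ ball 0 ρ`, bound `2‖φ‖‖f‖`;
* §3 **`derivMixed_step_rate_resolvent`** — THE JUNCTION WITH PART 8: for level families `A k, B k` (`‖A k‖ + ‖B k‖ ≤ a`, `ρ·a ≤ ½`), functionals
  `‖φ k‖ ≤ 1`, vectors `‖f k‖ ≤ 1`, a VALUE rate `c·θ^k` of `F k (s,t) = φ_k((1 + sA_k + tB_k)⁻¹ʳ f_k)` on the real square `[0,s₁]²`
  (`s₁·cosh 1 < ρ`) ALONE gives the mixed-derivative row the rate `((θ^{1−r})^{1−r′})^k` with PART 8's constant at `B = 2`; and the ∃θ END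
  `exists_derivMixed_geometricRate_resolvent`.
WHAT IT DOES NOT DO: S1 (the value rate — THE debt); the identification of Bałaban's `M_k(B(s,t))` with an operator family `1 + T_k(s,t)` on ONE
Banach space with `k`-uniform smallness (S2's dictionary — the minimisers `U_k(B)` enter; [B9] Thm 3.4's content); Schur-complement (Σ, Ξ) blocks
(an1's `Envelope` identities compose with §1 — not typed here); decay.  SUPPLIER work on route R6 (rank 2, KEEP-AS-REDUCTION, no seat); no consumer
of record; NOT one of the nine spine estimates; NEVER «G-an2-4 closed»; NOT (CONV-C), NOT D1, NOT `BetaPertH`, NOT continuum, NOT Clay.  Records: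
`HOME/b2b-balaban-gan24-p3/WOODBURY-FIBRE.md` v13.4.
-/

noncomputable section
open Set Metric
open scoped Ring

namespace Summit.QuantumFields.BalabanUV.Beta.GAN24.DerivativeRateTransferAnalyticResolvent

open Literature.MathematicalPhysics.QuantumFieldTheory.Balaban1983to89.B8SectDSource
  (isUnit_one_add norm_inverse_one_add_apply_le differentiableAt_inverse_one_add_apply)
open Summit.QuantumFields.BalabanUV.Beta.GAN24.DerivativeRateTransferAnalytic (rho_pos)
open Summit.QuantumFields.BalabanUV.Beta.GAN24.DerivativeRateTransferAnalyticMixed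
  (isOpen_bidisc derivMixed_step_rateω exists_derivMixed_geometricRate)

variable {F : Type*} [NormedAddCommGroup F] [NormedSpace ℂ F] [CompleteSpace F]

/-! ## §1 Entries of the Neumann inverse of a holomorphic operator family are holomorphic, with one bound -/

section Resolvent

variable {E : Type*} [NormedAddCommGroup E] [NormedSpace ℂ E] {T : E → (F →L[ℂ] F)} {U : Set E}

/-- **`differentiableOn_resolventEntry` — ANALYTICITY PASSES THROUGH THE NEUMANN INVERSION** [folklore; B8SectDSource §3 BY NAME]: `T` holomorphic on
the open set `U` of ANY complex normed parameter space `E` (here used with `E = ℂ × ℂ`; `E = ℂ` is the one-bond case) with `‖T z‖ < 1` there,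
`φ : F →L[ℂ] ℂ`, `f : F` ⇒ the entry `z ↦ φ ((1 + T z)⁻¹ʳ f)` is (jointly) holomorphic on `U`. -/
theorem differentiableOn_resolventEntry (hU : IsOpen U) (hT : DifferentiableOn ℂ T U) (h1 : ∀ z ∈ U, ‖T z‖ < 1)
    (φ : F →L[ℂ] ℂ) (f : F) : DifferentiableOn ℂ (fun z => φ ((1 + T z)⁻¹ʳ f)) U := fun z hz =>
  (φ.differentiableAt.comp z
    (differentiableAt_inverse_one_add_apply (hT.differentiableAt (hU.mem_nhds hz)) (h1 z hz) f)).differentiableWithinAt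

omit [NormedAddCommGroup E] [NormedSpace ℂ E] in
/-- **`norm_resolventEntry_le` — THE ONE BOUND** [folklore; B8SectDSource §3 BY NAME]: `‖T z‖ ≤ ϑ < 1` ⇒ `‖φ ((1 + T z)⁻¹ʳ f)‖ ≤ ‖φ‖·‖f‖∕(1 − ϑ)`. -/
theorem norm_resolventEntry_le {ϑ : ℝ} {z : E} (hT : ‖T z‖ ≤ ϑ) (hϑ : ϑ < 1) (φ : F →L[ℂ] ℂ) (f : F) :
    ‖φ ((1 + T z)⁻¹ʳ f)‖ ≤ ‖φ‖ * ‖f‖ / (1 - ϑ) := by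
  calc ‖φ ((1 + T z)⁻¹ʳ f)‖ ≤ ‖φ‖ * ‖(1 + T z)⁻¹ʳ f‖ := φ.le_opNorm _
    _ ≤ ‖φ‖ * (‖f‖ / (1 - ϑ)) := by gcongr; exact norm_inverse_one_add_apply_le (T z) hT hϑ f
    _ = ‖φ‖ * ‖f‖ / (1 - ϑ) := by ring

end Resolvent

/-! ## §2 The affine two-bond perturbation `T(s,t) = s•A + t•B` on the bidisc of radius `ρ` -/

section Affine

variable (A B : F →L[ℂ] F) {ρ : ℝ}

omit [CompleteSpace F] in
/-- [folklore] the affine family `z ↦ z.1 • A + z.2 • B` is (everywhere) holomorphic on `ℂ × ℂ`. -/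
theorem differentiable_affine₂ : Differentiable ℂ (fun z : ℂ × ℂ => z.1 • A + z.2 • B) :=
  (differentiable_fst.smul_const A).add (differentiable_snd.smul_const B)

omit [CompleteSpace F] in
/-- [folklore] on the bidisc of radius `ρ`: `‖s•A + t•B‖ ≤ ρ·(‖A‖ + ‖B‖)`. -/
theorem norm_affine₂_le {z : ℂ × ℂ} (hz : z ∈ ball (0 : ℂ) ρ ×ˢ ball (0 : ℂ) ρ) :
    ‖z.1 • A + z.2 • B‖ ≤ ρ * (‖A‖ + ‖B‖) := by
  obtain ⟨h1, h2⟩ := hz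
  rw [mem_ball_zero_iff] at h1 h2
  calc ‖z.1 • A + z.2 • B‖ ≤ ‖z.1 • A‖ + ‖z.2 • B‖ := norm_add_le _ _
    _ = ‖z.1‖ * ‖A‖ + ‖z.2‖ * ‖B‖ := by rw [norm_smul, norm_smul]
    _ ≤ ρ * ‖A‖ + ρ * ‖B‖ := by gcongr
    _ = ρ * (‖A‖ + ‖B‖) := by ring

omit [CompleteSpace F] in
/-- [folklore] the SMALL-BIDISC regime: `ρ·(‖A‖ + ‖B‖) ≤ ½` ⇒ `‖s•A + t•B‖ ≤ ½` on the bidisc. -/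
theorem norm_affine₂_le_half (hρ : ρ * (‖A‖ + ‖B‖) ≤ 1 / 2) {z : ℂ × ℂ} (hz : z ∈ ball (0 : ℂ) ρ ×ˢ ball (0 : ℂ) ρ) :
    ‖z.1 • A + z.2 • B‖ ≤ 1 / 2 :=
  (norm_affine₂_le A B hz).trans hρ

/-- **`resolventEntry_affine₂_hF` — PART 8's HOLOMORPHY HYPOTHESIS for the affine resolvent entry** [our proof]: with `ρ·(‖A‖ + ‖B‖) ≤ ½`,
`z ↦ φ ((1 + z.1•A + z.2•B)⁻¹ʳ f)` is holomorphic on `ball 0 ρ ×ˢ ball 0 ρ`. -/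
theorem resolventEntry_affine₂_hF (hρ : ρ * (‖A‖ + ‖B‖) ≤ 1 / 2) (φ : F →L[ℂ] ℂ) (f : F) :
    DifferentiableOn ℂ (fun z : ℂ × ℂ => φ ((1 + (z.1 • A + z.2 • B))⁻¹ʳ f)) (ball (0 : ℂ) ρ ×ˢ ball (0 : ℂ) ρ) :=
  differentiableOn_resolventEntry (T := fun z : ℂ × ℂ => z.1 • A + z.2 • B) isOpen_bidisc
    (differentiable_affine₂ A B).differentiableOn
    (fun z hz => (norm_affine₂_le_half A B hρ hz).trans_lt (by norm_num)) φ f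

/-- **`resolventEntry_affine₂_hB` — PART 8's BOUND HYPOTHESIS for the affine resolvent entry** [our proof]: with `ρ·(‖A‖ + ‖B‖) ≤ ½`,
`‖φ ((1 + z.1•A + z.2•B)⁻¹ʳ f)‖ ≤ 2·‖φ‖·‖f‖` on `ball 0 ρ ×ˢ ball 0 ρ`. -/
theorem resolventEntry_affine₂_hB (hρ : ρ * (‖A‖ + ‖B‖) ≤ 1 / 2) (φ : F →L[ℂ] ℂ) (f : F)
    {z : ℂ × ℂ} (hz : z ∈ ball (0 : ℂ) ρ ×ˢ ball (0 : ℂ) ρ) :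
    ‖φ ((1 + (z.1 • A + z.2 • B))⁻¹ʳ f)‖ ≤ 2 * ‖φ‖ * ‖f‖ := by
  have h := norm_resolventEntry_le (T := fun z : ℂ × ℂ => z.1 • A + z.2 • B) (z := z)
    (norm_affine₂_le_half A B hρ hz) (by norm_num) φ f
  calc ‖φ ((1 + (z.1 • A + z.2 • B))⁻¹ʳ f)‖ ≤ ‖φ‖ * ‖f‖ / (1 - 1 / 2) := h
    _ = 2 * ‖φ‖ * ‖f‖ := by ring

end Affine

/-! ## §3 The junction with PART 8: for affine resolvent entries ONLY the value rate (S1) is a hypothesis -/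

section Junction

variable {A B : ℕ → (F →L[ℂ] F)} {φ : ℕ → (F →L[ℂ] ℂ)} {f : ℕ → F} {ρ s₁ a c θ : ℝ}

/-- **`derivMixed_step_rate_resolvent` — THE MIXED u-ROW OF AN AFFINE RESOLVENT ENTRY FAMILY, MODULO S1 ALONE** [our proof]: level families of
bounded operators `A k, B k` on a complex Banach space with `‖A k‖ + ‖B k‖ ≤ a`, a bidisc radius `ρ` with `ρ·a ≤ ½`, functionals `‖φ k‖ ≤ 1` and
vectors `‖f k‖ ≤ 1` (normalisations), and the entry family `F k (s,t) := φ_k ((1 + sA_k + tB_k)⁻¹ʳ f_k)`.  IF (S1) `‖F (k+1) (s,t) − F k (s,t)‖ ≤ c·θ^k`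
on the real square `[0,s₁]²` (`0 < c`, `0 < θ`, `0 < s₁`, `s₁·cosh 1 < ρ`), THEN for all `r, r′ ∈ ]0,1]` and every `k` the mixed row obeys
PART 8's bound with `B = 2`:
`‖∂_t∂_sF_{k+1}(0,0) − ∂_t∂_sF_k(0,0)‖ ≤ 25·(2·(8∕ρ))^{r′}∕(s₁r′²) · (25·4^r∕(s₁r²)·c^{1−r})^{1−r′} · ((θ^{1−r})^{1−r′})^k` — NO analytic hypothesis left. -/
theorem derivMixed_step_rate_resolvent (hs₁ : 0 < s₁) (hs₁ρ : s₁ * Real.cosh 1 < ρ)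
    (hAB : ∀ k, ‖A k‖ + ‖B k‖ ≤ a) (hρa : ρ * a ≤ 1 / 2) (hφ : ∀ k, ‖φ k‖ ≤ 1) (hf : ∀ k, ‖f k‖ ≤ 1)
    (hval : ∀ k (s t : ℝ), 0 ≤ s → s ≤ s₁ → 0 ≤ t → t ≤ s₁ →
      ‖φ (k + 1) ((1 + (((s : ℂ) • A (k + 1) + (t : ℂ) • B (k + 1))))⁻¹ʳ (f (k + 1)))
        - φ k ((1 + (((s : ℂ) • A k + (t : ℂ) • B k)))⁻¹ʳ (f k))‖ ≤ c * θ ^ k)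
    (hc : 0 < c) (hθ : 0 < θ) {r r' : ℝ} (hr : 0 < r) (hr1 : r ≤ 1) (hr' : 0 < r') (hr'1 : r' ≤ 1) (k : ℕ) :
    ‖deriv (fun t : ℂ => deriv (fun s : ℂ => φ (k + 1) ((1 + (s • A (k + 1) + t • B (k + 1)))⁻¹ʳ (f (k + 1)))) 0) 0
        - deriv (fun t : ℂ => deriv (fun s : ℂ => φ k ((1 + (s • A k + t • B k))⁻¹ʳ (f k))) 0) 0‖ ≤
      25 * (2 * (4 * 2 / ρ)) ^ r' / (s₁ * r' ^ 2) * (25 * (2 * 2) ^ r / (s₁ * r ^ 2) * c ^ (1 - r)) ^ (1 - r')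
        * ((θ ^ (1 - r)) ^ (1 - r')) ^ k := by
  have hρ : 0 < ρ := rho_pos hs₁ hs₁ρ
  -- the bidisc smallness for each level
  have hρk : ∀ k, ρ * (‖A k‖ + ‖B k‖) ≤ 1 / 2 := fun k =>
    (mul_le_mul_of_nonneg_left (hAB k) hρ.le).trans hρa
  -- PART 8 on the entry family `F k z := φ k ((1 + z.1•A k + z.2•B k)⁻¹ʳ (f k))`, bound `B = 2`
  have key := derivMixed_step_rateω
    (F := fun k (z : ℂ × ℂ) => φ k ((1 + (z.1 • A k + z.2 • B k))⁻¹ʳ (f k))) (B := 2) hs₁ hs₁ρ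
    (fun k => resolventEntry_affine₂_hF (A k) (B k) (hρk k) (φ k) (f k))
    (fun k z hz => by
      have h := resolventEntry_affine₂_hB (A k) (B k) (hρk k) (φ k) (f k) hz
      have h2 : 2 * ‖φ k‖ * ‖f k‖ ≤ 2 := by
        have := mul_le_mul (hφ k) (hf k) (norm_nonneg _) zero_le_one
        linarith
      exact h.trans h2)
    (by norm_num) (fun k s t hs0 hs1 ht0 ht1 => hval k s t hs0 hs1 ht0 ht1) hc hθ hr hr1 hr' hr'1 k
  simpa using key

/-- **`exists_derivMixed_geometricRate_resolvent` — THE ∃θ END, MODULO S1 ALONE** [our proof]: under the hypotheses of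
`derivMixed_step_rate_resolvent` with `θ < 1`, the mixed row of the affine resolvent entry family is geometric:
`∃ c″ θ″, 0 ≤ c″ ∧ 0 ≤ θ″ ∧ θ″ < 1 ∧ ∀ k, ‖∂_t∂_sF_{k+1}(0,0) − ∂_t∂_sF_k(0,0)‖ ≤ c″·θ″^k`. -/
theorem exists_derivMixed_geometricRate_resolvent (hs₁ : 0 < s₁) (hs₁ρ : s₁ * Real.cosh 1 < ρ)
    (hAB : ∀ k, ‖A k‖ + ‖B k‖ ≤ a) (hρa : ρ * a ≤ 1 / 2) (hφ : ∀ k, ‖φ k‖ ≤ 1) (hf : ∀ k, ‖f k‖ ≤ 1)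
    (hval : ∀ k (s t : ℝ), 0 ≤ s → s ≤ s₁ → 0 ≤ t → t ≤ s₁ →
      ‖φ (k + 1) ((1 + (((s : ℂ) • A (k + 1) + (t : ℂ) • B (k + 1))))⁻¹ʳ (f (k + 1)))
        - φ k ((1 + (((s : ℂ) • A k + (t : ℂ) • B k)))⁻¹ʳ (f k))‖ ≤ c * θ ^ k)
    (hc : 0 < c) (hθ : 0 < θ) (hθ1 : θ < 1) :
    ∃ c'' θ'' : ℝ, 0 ≤ c'' ∧ 0 ≤ θ'' ∧ θ'' < 1 ∧ ∀ k,
      ‖deriv (fun t : ℂ => deriv (fun s : ℂ => φ (k + 1) ((1 + (s • A (k + 1) + t • B (k + 1)))⁻¹ʳ (f (k + 1)))) 0) 0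
          - deriv (fun t : ℂ => deriv (fun s : ℂ => φ k ((1 + (s • A k + t • B k))⁻¹ʳ (f k))) 0) 0‖ ≤ c'' * θ'' ^ k := by
  have hρ : 0 < ρ := rho_pos hs₁ hs₁ρ
  have hρk : ∀ k, ρ * (‖A k‖ + ‖B k‖) ≤ 1 / 2 := fun k =>
    (mul_le_mul_of_nonneg_left (hAB k) hρ.le).trans hρa
  have key := exists_derivMixed_geometricRate
    (F := fun k (z : ℂ × ℂ) => φ k ((1 + (z.1 • A k + z.2 • B k))⁻¹ʳ (f k))) (B := 2) hs₁ hs₁ρ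
    (fun k => resolventEntry_affine₂_hF (A k) (B k) (hρk k) (φ k) (f k))
    (fun k z hz => by
      have h := resolventEntry_affine₂_hB (A k) (B k) (hρk k) (φ k) (f k) hz
      have h2 : 2 * ‖φ k‖ * ‖f k‖ ≤ 2 := by
        have := mul_le_mul (hφ k) (hf k) (norm_nonneg _) zero_le_one
        linarith
      exact h.trans h2)
    (by norm_num) (fun k s t hs0 hs1 ht0 ht1 => hval k s t hs0 hs1 ht0 ht1) hc hθ hθ1
  simpa using key

end Junction

end Summit.QuantumFields.BalabanUV.Beta.GAN24.DerivativeRateTransferAnalyticResolvent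

end
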